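import Summits.QuantumFields.YangMills.Theses.ParabolicTrajectory
import Literature.MathematicalPhysics.QuantumLattice.BoundedWilsonFlowLift
import Summits.QuantumFields.YangMills.Theorems.ContinuumLimitOnTrajectory.Negative.UltralocalNoLimit
import HarnessLib.Audit

/-!
# Line `curtiss-flowed-free-energies` — crux `ContinuumLimitOnTrajectory` (stmt-QuantumFields-10522)

Skeleton of the line "correlators are Taylor coefficients: convergence of FLOWED FREE ENERGIES
with small real sources ⇒ (Curtiss) convergence of all flowed cumulants ⇒ (small flow time)
convergence of the canonical curvature functionals on `⁰𝒮` ⇒ (OS packaging) the conclusion of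
crux (A)", route `ParabolicTrajectory` of `YangMills`.

Namespace `Summit.QuantumFields.YangMills.Cruxes.ContinuumLimitOnTrajectory.CurtissFlowedFreeEnergies`.
Registered stubs (7): `stub_flowedFreeEnergyLimit` (ENGINE, borrowed — hardest),
`stub_jointMomentsOfMGFLimit` (Curtiss, the lever), `stub_smallFlowTimeTransfer`,
`stub_uniformClustering`, `stub_rotationRestoration`, `stub_nonDegeneracy`, `stub_osPackaging`;
composition `ContinuumLimitOnTrajectory_of` (kernel-checked, no `sorry`; it contains the 3ε step
"flowed moments converge at every flow time + uniform small-flow-time approximation ⇒ the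
unflowed canonical functionals converge along the FULL sequence").

## Objects (all over existing declarations)

* `canon r sch` — the witness scheme `sch'` of the crux: same `(a, β, L)` as `sch`, curvature
  species with the CANONICAL weight `c_k = a_k⁻⁴` and the EXACT vacuum subtraction
  `m_k = ⟨P ∘ torusLift⟩_k`, every other species zeroed (`c_s = m_s = 0`; Disproof §4: `c_k` is
  determined up to `o(1)` and sign by the bare data, `m_k` is invisible in connected functions).
* `flowX r sch τ f k U = ∑_{x ∈ box} f(a_k x) · E_{τ/a_k²}(x)(Ũ)` — the flowed action density
  (Lüscher (3.1), tree `boundedFlowedEnergy r.ρ`, lattice flow time `τ/a_k²` = PHYSICAL flow time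
  `τ`) smeared with a real test function; no explicit `a⁴`: the Riemann weight `a⁴` cancels the
  canonical weight `a⁻⁴` of the dimension-4 density (triage r1-2 sharpening "say so").
* `flowF` — the flowed free energy `log ∫ exp(∑ᵢ sᵢ Xⁱ) dμ_k` (joint cumulant generating function);
  `flowCMoment` — the centred mixed flowed moment `∫ ∏ᵢ (Xⁱ − ⟨Xⁱ⟩) dμ_k`.
* `curvLS r sch k n F` — the canonical curvature `n`-point functional on a GENERAL tensor
  `F ∈ 𝓢((ℝ⁴)ⁿ)` (as in route `FlowLineStateSpace`, with `c a⁴ = 1`, exact vacuum subtraction).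
* `CruxHyp` / `CruxConcl` — read-back of the crux (= `Disproof.Hyp` / `Disproof.Concl`).

## Disproof used

`Disproof.lean` (cdisprove gen 3) `Ultralocal.not_withoutAF_unconditional` = landed
`Negative.continuumLimitOnTrajectory_false_without_AF`: any proof must use the pair
{`β_k → ∞`, `θ > 0`}. This line uses it at `stub_flowedFreeEnergyLimit` (the whole `CruxHyp`,
incl. AF and the tuning window) and at `stub_nonDegeneracy` (`θ > 0` ⇒ ND); on the `β ≡ 0`
ultralocal scheme ND fails, as it must (`Negative.not_isNontrivial_beta_zero`). No stub is an
instance of a landed Negative lemma (`Negative/{Ultralocal*,WitnessRigidity,PinnedSector,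
Interleaving,ThreePoint,NecessaryConditions}` are necessary conditions / junk-model facts).
-/

open scoped SchwartzMap
open MeasureTheory Filter Topology
open Literature.MathematicalPhysics.AQFT Literature.MathematicalPhysics.QuantumLattice
open Literature.Probability.LatticeModels
open Literature.MathematicalPhysics.QuantumFieldTheory
open Summit.QuantumFields.YangMills.Theses.ParabolicTrajectory

noncomputable section

namespace Summit.QuantumFields.YangMills.Cruxes.ContinuumLimitOnTrajectory.CurtissFlowedFreeEnergies

local notation "𝔼" => EuclideanSpace ℝ (Fin 4)

/-! ### Objects -/

section Objects

variable {G : Type} [Group G] [TopologicalSpace G] [IsTopologicalGroup G] [CompactSpace G]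
  [MeasurableSpace G] [BorelSpace G]

/-- The torus Wilson measure of the scheme at step `k` (side `2 L_k + 1`, coupling `β_k`). [folklore] -/
abbrev μW (r : LatticeRep G) (sch : SpeciesScheme (YMSpecies G)) (k : ℕ) :
    Measure (GaugeConfig 4 (sch.side k) G) :=
  wilsonMeasure (d := 4) (L := sch.side k) r.ρ (sch.β k)

/-- Exact vacuum subtraction: the torus expectation of the action density at step `k`. [folklore] -/
def vacMean (r : LatticeRep G) (sch : SpeciesScheme (YMSpecies G)) (k : ℕ) : ℝ :=
  ∫ U, r.curvature.F (torusLift (sch.side k) U) ∂(μW r sch k)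

open Classical in
/-- **The canonical witness scheme** `sch'`: same `(a, β, L)`; curvature weight `c_k = a_k⁻⁴`,
exact vacuum subtraction; all other species zeroed. [folklore] -/
def canon (r : LatticeRep G) (sch : SpeciesScheme (YMSpecies G)) : SpeciesScheme (YMSpecies G) where
  a := sch.a
  a_pos := sch.a_pos
  tendsto_a := sch.tendsto_a
  β := sch.β
  L := sch.L
  tendsto_L := sch.tendsto_L
  c := fun s k => if s = r.curvature then (sch.a k ^ 4)⁻¹ else 0
  m := fun s k => if s = r.curvature then vacMean r sch k else 0

@[simp] theorem canon_a (r : LatticeRep G) (sch : SpeciesScheme (YMSpecies G)) :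
    (canon r sch).a = sch.a := rfl
@[simp] theorem canon_β (r : LatticeRep G) (sch : SpeciesScheme (YMSpecies G)) :
    (canon r sch).β = sch.β := rfl
@[simp] theorem canon_L (r : LatticeRep G) (sch : SpeciesScheme (YMSpecies G)) :
    (canon r sch).L = sch.L := rfl

/-- **The canonical curvature `n`-point functional on a general tensor** `F ∈ 𝓢((ℝ⁴)ⁿ, ℂ)`:
`∫ ∑_{x ∈ boxⁿ} F(a_k x) ∏ᵢ (P(τ_{xᵢ} Ũ) − ⟨P⟩_k) dμ_k` (weight `c_k a_k⁴ = 1` per point). On a real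
product tensor `⊗ᵢ fᵢ` it is `latticeSchwinger r.ρ (canon r sch) _ k n (fun _ => r.curvature) f`
(sum–product interchange; part of `stub_osPackaging`). [folklore] -/
def curvLS (r : LatticeRep G) (sch : SpeciesScheme (YMSpecies G)) (k n : ℕ)
    (F : 𝓢((Fin n → 𝔼), ℂ)) : ℂ :=
  ∫ U, ∑ x : Fin n → ↥(box 4 (sch.L k)),
      F (fun i => sch.a k • siteToE (↑(x i) : Literature.Probability.LatticeModels.Site 4)) *
        ∏ i, (((r.curvature.F (configShift (-(↑(x i) : Literature.Probability.LatticeModels.Site 4))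
          (torusLift (sch.side k) U)) - vacMean r sch k : ℝ) : ℂ)) ∂(μW r sch k)

/-- **The smeared flowed action density at physical flow time `τ`**:
`X_k(τ, f)(U) = ∑_{x ∈ box} f(a_k x) · E_{τ/a_k²}(x)(Ũ)` with `E_t(x)` Lüscher's flowed plaquette
density (3.1) along the (bounded = torus) Wilson flow through `r.ρ` (tree `boundedFlowedEnergy`,
`boundedFlowedEnergy_torusLift`). [cite: Luscher2010, eqs. (1.4), (3.1)] -/
def flowX (r : LatticeRep G) (sch : SpeciesScheme (YMSpecies G)) (τ : ℝ) (f : 𝓢(𝔼, ℝ)) (k : ℕ)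
    (U : GaugeConfig 4 (sch.side k) G) : ℝ :=
  ∑ x ∈ box 4 (sch.L k), f (sch.a k • siteToE x) *
    boundedFlowedEnergy r.ρ (τ / sch.a k ^ 2) x (torusLift (sch.side k) U)

/-- **The flowed free energy with real sources** `F_k(s⃗) = log ∫ exp(∑ᵢ sᵢ X_k(τ, fᵢ)) dμ_k`
(the joint cumulant generating function of the flowed smeared densities). [folklore] -/
def flowF (r : LatticeRep G) (sch : SpeciesScheme (YMSpecies G)) (τ : ℝ) (m : ℕ)
    (f : Fin m → 𝓢(𝔼, ℝ)) (s : Fin m → ℝ) (k : ℕ) : ℝ :=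
  Real.log (∫ U, Real.exp (∑ i, s i * flowX r sch τ (f i) k U) ∂(μW r sch k))

/-- **The centred mixed flowed moment** `∫ ∏ᵢ (X_k(τ,fᵢ) − ⟨X_k(τ,fᵢ)⟩_k) dμ_k`. [folklore] -/
def flowCMoment (r : LatticeRep G) (sch : SpeciesScheme (YMSpecies G)) (τ : ℝ) (m : ℕ)
    (f : Fin m → 𝓢(𝔼, ℝ)) (k : ℕ) : ℝ :=
  ∫ U, ∏ i, (flowX r sch τ (f i) k U - ∫ V, flowX r sch τ (f i) k V ∂(μW r sch k)) ∂(μW r sch k)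

/-! ### Read-back of the crux and the intermediate stations of the line -/

/-- **Hypothesis block of the crux** for `(r, M, θ, Δ, sch, n)` (= `Disproof.Hyp`): `M`-adic
spacings, `β_k → ∞`, every `N_t` convergent, `N_1 → θ`, uniform lattice gap `Δ`. [folklore] -/
def CruxHyp (r : LatticeRep G) (M : ℕ) (θ Δ : ℝ) (sch : SpeciesScheme (YMSpecies G)) (n : ℕ → ℕ) :
    Prop :=
  (∀ k, sch.a k = ((M : ℝ) ^ n k)⁻¹) ∧ Tendsto sch.β atTop atTop ∧
    (∀ t : ℕ, 0 < t → ∃ c : ℝ, Tendsto (fun k => ((M : ℝ) ^ n k) ^ 8 *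
      latticeConnectedCorr r.ρ (sch.β k) (sch.side k) r.curvature.F r.curvature.F (t * M ^ n k))
        atTop (𝓝 c)) ∧
    Tendsto (fun k => ((M : ℝ) ^ n k) ^ 8 *
      latticeConnectedCorr r.ρ (sch.β k) (sch.side k) r.curvature.F r.curvature.F (M ^ n k))
        atTop (𝓝 θ) ∧
    HasLatticeMassGap r sch Δ

/-- (ENGINE output) **flowed free energies converge**: for every finite family of real test
functions and every physical flow time `τ > 0` there is a real source radius `δ > 0` inside which
`F_k(s⃗)` converges along the FULL sequence. [folklore] -/
def FFEConv (r : LatticeRep G) (sch : SpeciesScheme (YMSpecies G)) : Prop :=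
  ∀ (m : ℕ) (f : Fin m → 𝓢(𝔼, ℝ)) (τ : ℝ), 0 < τ → ∃ δ : ℝ, 0 < δ ∧
    ∀ s : Fin m → ℝ, (∀ i, |s i| < δ) → ∃ c : ℝ, Tendsto (fun k => flowF r sch τ m f s k) atTop (𝓝 c)

/-- (CURTISS output) **all centred mixed flowed moments converge**, every family, every `τ > 0`. [folklore] -/
def FlowMomentsConv (r : LatticeRep G) (sch : SpeciesScheme (YMSpecies G)) : Prop :=
  ∀ (m : ℕ) (f : Fin m → 𝓢(𝔼, ℝ)) (τ : ℝ), 0 < τ →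
    ∃ c : ℝ, Tendsto (fun k => flowCMoment r sch τ m f k) atTop (𝓝 c)

/-- (SMALL FLOW TIME) **uniform small-flow-time approximation at separated points**: one matching
function `c_E(τ)` such that for every off-diagonal real product tensor the canonical UNFLOWED
`n`-point functional is within `ε` of `c_E(τ)ⁿ ×` the centred flowed moment, for `τ` small and all
large `k` (uniformity in `k` is the content). [cite: arXiv:1306.1173] -/
def SFTApprox (r : LatticeRep G) (sch : SpeciesScheme (YMSpecies G)) : Prop :=
  ∃ cE : ℝ → ℝ, ∀ (m : ℕ), m ≠ 0 → ∀ (f : Fin m → 𝓢(𝔼, ℝ)) (F : 𝓢((Fin m → 𝔼), ℂ)),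
    IsTensorOf F (fun i => ofRealTest (f i)) → IsOffDiagonal F →
      ∀ ε : ℝ, 0 < ε → ∃ τ : ℝ, 0 < τ ∧ ∀ᶠ k in atTop,
        |latticeSchwinger r.ρ (canon r sch) (fun s => s.F) k m (fun _ => r.curvature) f -
            cE τ ^ m * flowCMoment r sch τ m f k| ≤ ε

/-- (CONV) **full-sequence convergence of the canonical curvature functionals** on off-diagonal
real product tensors (exactly the data `IsYangMillsFor` consumes for the curvature string). [folklore] -/
def CurvConv (r : LatticeRep G) (sch : SpeciesScheme (YMSpecies G)) : Prop :=
  ∀ (m : ℕ), m ≠ 0 → ∀ (f : Fin m → 𝓢(𝔼, ℝ)) (F : 𝓢((Fin m → 𝔼), ℂ)),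
    IsTensorOf F (fun i => ofRealTest (f i)) → IsOffDiagonal F →
      ∃ c : ℝ, Tendsto
        (fun k => latticeSchwinger r.ρ (canon r sch) (fun s => s.F) k m (fun _ => r.curvature) f)
        atTop (𝓝 c)

/-- (UVB) **uniform OS linear-growth bounds** of the canonical functionals on `⁰𝒮`, uniform in
`k ≥ k₀` and in the tensor (E0' format `α (n!)^β |F|_{ns}`). [cite: OsterwalderSchrader1975, §2 (E0')] -/
def UVB (r : LatticeRep G) (sch : SpeciesScheme (YMSpecies G)) : Prop :=
  ∃ (s : ℕ) (α β : ℝ), ∀ᶠ k in atTop, ∀ (n : ℕ) (F : 𝓢((Fin n → 𝔼), ℂ)), IsOffDiagonal F →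
    ‖curvLS r sch k n F‖ ≤ α * (n.factorial : ℝ) ^ β * schwartzNorm (n * s) F

/-- (CL) **uniform clustering in OS form**: (time part, the format of `OSData.HasMassGap`)
EXPONENTIAL clustering at a rate `Δ > 0` under time translations of a time-ordered `G'` against a
reflected time-ordered `F` (supports exactly separated in time, so the rate is uniform over
Schwartz test functions), with `k`-uniform constants; (spatial part, the format of E4)
QUALITATIVE clustering under purely spatial translations `t • a`, `a⁰ = 0`, `a ≠ 0`, uniformly in
large `k` (no exponential rate is asked: Schwartz tails in space forbid one). [cite: GlimmJaffe1987, Thm 6.1.3] -/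
def CL (r : LatticeRep G) (sch : SpeciesScheme (YMSpecies G)) : Prop :=
  (∃ Δ : ℝ, 0 < Δ ∧ ∀ (n m : ℕ) (F : 𝓢((Fin n → 𝔼), ℂ)) (G' : 𝓢((Fin m → 𝔼), ℂ)),
    IsTimeOrdered F → IsTimeOrdered G' → ∃ C : ℝ, ∀ t : ℝ, 0 ≤ t → ∀ᶠ k in atTop,
      ∀ H : 𝓢((Fin (n + m) → 𝔼), ℂ),
        IsAppendTensorOf H (osAdjoint F) (translateMulti (EuclideanSpace.single 0 t) G') →
          ‖curvLS r sch k (n + m) H - curvLS r sch k n (osAdjoint F) * curvLS r sch k m G'‖ ≤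
            C * Real.exp (-Δ * t)) ∧
  (∀ (n m : ℕ) (F : 𝓢((Fin n → 𝔼), ℂ)) (G' : 𝓢((Fin m → 𝔼), ℂ)),
    IsTimeOrdered F → IsTimeOrdered G' → ∀ a : 𝔼, a 0 = 0 → a ≠ 0 → ∀ ε : ℝ, 0 < ε →
      ∃ t₀ : ℝ, ∀ t : ℝ, t₀ ≤ t → ∀ᶠ k in atTop, ∀ H : 𝓢((Fin (n + m) → 𝔼), ℂ),
        IsAppendTensorOf H (osAdjoint F) (translateMulti (t • a) G') →
          ‖curvLS r sch k (n + m) H - curvLS r sch k n (osAdjoint F) * curvLS r sch k m G'‖ ≤ ε)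

/-- (ROT) **asymptotic restoration of proper rotations on `⁰𝒮`** (E1 input). [cite: OsterwalderSchrader1975, §3 (E1)] -/
def ROT (r : LatticeRep G) (sch : SpeciesScheme (YMSpecies G)) : Prop :=
  ∀ (n : ℕ) (F : 𝓢((Fin n → 𝔼), ℂ)), IsOffDiagonal F → ∀ R : 𝔼 ≃ₗᵢ[ℝ] 𝔼,
    LinearMap.det (R.toLinearEquiv : 𝔼 →ₗ[ℝ] 𝔼) = 1 →
      Tendsto (fun k : ℕ => curvLS r sch k n (linActMulti R F - F)) atTop (𝓝 0)

/-- (ND) **a two-point lower bound**: some OS pair `θf* ⊗ g` keeps the canonical two-point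
functional `≥ δ > 0` eventually (feeds `IsNontrivial`). [folklore] -/
def ND (r : LatticeRep G) (sch : SpeciesScheme (YMSpecies G)) : Prop :=
  ∃ (f g : 𝓢((Fin 1 → 𝔼), ℂ)) (H : 𝓢((Fin (1 + 1) → 𝔼), ℂ)),
    IsTimeOrdered f ∧ IsTimeOrdered g ∧ IsAppendTensorOf H (osAdjoint f) g ∧
      ∃ δ : ℝ, 0 < δ ∧ ∀ᶠ k in atTop, δ ≤ ‖curvLS r sch k (1 + 1) H‖

/-- (NG) **a three-point lower bound** on an off-diagonal tensor, infinitely often (feeds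
`IsNonGaussian`; the vacuum subtraction makes `curvLS k 3` the connected function). [folklore] -/
def NG (r : LatticeRep G) (sch : SpeciesScheme (YMSpecies G)) : Prop :=
  ∃ (f g h : 𝓢(𝔼, ℂ)) (F₃ : 𝓢((Fin 3 → 𝔼), ℂ)), IsTensorOf F₃ ![f, g, h] ∧ IsOffDiagonal F₃ ∧
    ∃ δ : ℝ, 0 < δ ∧ ∃ᶠ k in atTop, δ ≤ ‖curvLS r sch k 3 F₃‖

/-- **Conclusion of the crux** for `(r, sch)` (= `Disproof.Concl`). [folklore] -/
def CruxConcl (r : LatticeRep G) (sch : SpeciesScheme (YMSpecies G)) : Prop :=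
  ∃ sch' : SpeciesScheme (YMSpecies G), sch'.a = sch.a ∧ sch'.β = sch.β ∧ sch'.L = sch.L ∧
    ∃ T : OSData (YMSpecies G) 4,
      IsYangMillsFor r sch' T ∧ T.IsNontrivial r.curvature ∧ T.IsNonGaussian r.curvature

end Objects

/-! ### Stub statements (closed `Prop`s) -/

/-- **Stub 1 — ENGINE (borrowed; carries the universality content; hardest).** Along every
scheme in the crux's hypothesis block (block factor `M ≥ M₀(G,r)`, tuning window `θ < θ₀`), the
flowed free energies with small REAL sources converge along the full sequence, for every finite
family of real test functions and every physical flow time `τ > 0`. A source `s ∫ J E_τ` is a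
bounded smooth quasi-local perturbation of Wilson's action at scale `√τ`, so this is the scalar
(partition-function) form of (A); any of the crux's engines (route chart + `ParabolicCentreCurve`
applied to the scalar observable `F(·; s⃗)`, `jacobian-collapse-gronwall`, `two-orbit`/`pin-slave`)
is a candidate proof. Honours `not_withoutAF`: uses AF and `θ > 0` through `CruxHyp`. -/
def FlowedFreeEnergyLimit : Prop :=
  ∀ (G : Type) [Group G] [TopologicalSpace G] [IsTopologicalGroup G] [CompactSpace G],
    IsCompactSimpleLieGroup G →
      letI : MeasurableSpace G := borel G
      haveI : BorelSpace G := ⟨rfl⟩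
      ∀ r : LatticeRep G, ∃ M₀ : ℕ, ∀ M : ℕ, M₀ ≤ M → 2 ≤ M → ∃ θ₀ : ℝ, 0 < θ₀ ∧
        ∀ (θ Δ : ℝ) (sch : SpeciesScheme (YMSpecies G)) (n : ℕ → ℕ),
          0 < θ → θ < θ₀ → 0 < Δ → CruxHyp r M θ Δ sch n → FFEConv r sch

/-- **Stub 2 — CURTISS (the lever; true, M).** Convergence of the flowed free energies on a real
neighbourhood of `s⃗ = 0` ⇒ convergence of every centred mixed flowed moment: Curtiss 1942
(multivariate: joint MGFs converging on a neighbourhood of `0` ⇒ exponential moments bounded in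
`k` at each small `s⃗` ⇒ uniform integrability of polynomials ⇒ joint moments converge, via
Vitali on the strip) applied to `(X_k(τ,f₁),…,X_k(τ,f_m))`; needs the two helper lemmas
"abstract multivariate Curtiss" and "the torus Wilson flow through `r.ρ` exists for all times and
is continuous in the initial data" (Picard–Lindelöf for the closed subgroup `range ρ ⊆ U(N)`,
uniqueness is the tree's `IsWilsonFlowLine.unique_of_finite`), whence `flowX` is continuous and
the integrals are genuine. [cite: doi:10.1214/aoms/1177731541] -/
def JointMomentsOfMGFLimit : Prop :=
  ∀ (G : Type) [Group G] [TopologicalSpace G] [IsTopologicalGroup G] [CompactSpace G],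
    IsCompactSimpleLieGroup G →
      letI : MeasurableSpace G := borel G
      haveI : BorelSpace G := ⟨rfl⟩
      ∀ (r : LatticeRep G) (sch : SpeciesScheme (YMSpecies G)), FFEConv r sch → FlowMomentsConv r sch

/-- **Stub 3 — SMALL-FLOW-TIME TRANSFER (L/open).** Along every scheme of the hypothesis block:
(a) `SFTApprox` — a `k`-UNIFORM small-flow-time expansion of the curvature species at separated
points: `E_τ = c_E(τ)·[a⁻⁴(P − ⟨P⟩)] + O(τ)` inside correlators with off-diagonal real product
tensors (Lüscher–Weisz: flowed composites need no renormalisation; Suzuki / Del Debbio–Patella–Rago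
small-flow-time expansion), the matching `c_E(τ)` relating two canonically weighted lattice
densities; (b) `UVB` — uniform OS linear-growth bounds of the canonical functionals on `⁰𝒮`
(Cauchy estimates on the flowed free energies at flow time adapted to the separation scale, a
chessboard bound on the real source radius, dyadic decomposition at the diagonals). Both are
universality-type UV inputs (triage r1-1: "should be a named stub"). [cite: arXiv:1306.1173] [cite: arXiv:1101.0963] -/
def SmallFlowTimeTransfer : Prop :=
  ∀ (G : Type) [Group G] [TopologicalSpace G] [IsTopologicalGroup G] [CompactSpace G],
    IsCompactSimpleLieGroup G →
      letI : MeasurableSpace G := borel G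
      haveI : BorelSpace G := ⟨rfl⟩
      ∀ (r : LatticeRep G) (M : ℕ) (θ Δ : ℝ) (sch : SpeciesScheme (YMSpecies G)) (n : ℕ → ℕ),
        2 ≤ M → 0 < θ → 0 < Δ → CruxHyp r M θ Δ sch n → SFTApprox r sch ∧ UVB r sch

/-- **Stub 4 — UNIFORM CLUSTERING (IR junction, L).** The crux's volume-uniform lattice gap
`HasLatticeMassGap r sch Δ` (all pairs of gauge-invariant observables, all tori `≥` the scheme's),
upgraded through reflection positivity to a spectral gap `e^{-a_k Δ}` of the transfer matrix
(species-wise constants are NOT enough for smeared products — this upgrade is the content), gives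
the time part of `CL` with constants `‖Φ_k(F)Ω‖·‖Φ_k(G')Ω‖` (two-point data, `k`-uniform by
`UVB`; supports exactly separated in time); the spatial part (qualitative, E4 format) follows
along one lattice axis with `a_j ≠ 0` by the hypercubic symmetry of the torus measure, Schwartz
tails cut off with `UVB`. [cite: OsterwalderSeiler1978, §§2–3] [cite: GlimmJaffe1987, Thm 6.1.3] -/
def UniformClustering : Prop :=
  ∀ (G : Type) [Group G] [TopologicalSpace G] [IsTopologicalGroup G] [CompactSpace G],
    IsCompactSimpleLieGroup G →
      letI : MeasurableSpace G := borel G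
      haveI : BorelSpace G := ⟨rfl⟩
      ∀ (r : LatticeRep G) (M : ℕ) (θ Δ : ℝ) (sch : SpeciesScheme (YMSpecies G)) (n : ℕ → ℕ),
        2 ≤ M → 0 < θ → 0 < Δ → CruxHyp r M θ Δ sch n → UVB r sch → CL r sch

/-- **Stub 5 — ROTATION RESTORATION (E1; imported complement, open).** Along every scheme of
the hypothesis block whose canonical functionals converge, proper rotations are restored on `⁰𝒮`:
`curvLS_k(R·F − F) → 0` (irrelevance of the dimension-6 hypercubic operators; owned by the E1
cards; this line only consumes it — Disproof §7 `crux_imp_isotropicRatio` is the matching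
necessary condition). [cite: Literature.Barriers.QuantumFields.RegularisationDichotomy] -/
def RotationRestoration : Prop :=
  ∀ (G : Type) [Group G] [TopologicalSpace G] [IsTopologicalGroup G] [CompactSpace G],
    IsCompactSimpleLieGroup G →
      letI : MeasurableSpace G := borel G
      haveI : BorelSpace G := ⟨rfl⟩
      ∀ (r : LatticeRep G) (M : ℕ) (θ Δ : ℝ) (sch : SpeciesScheme (YMSpecies G)) (n : ℕ → ℕ),
        2 ≤ M → 0 < θ → 0 < Δ → CruxHyp r M θ Δ sch n → CurvConv r sch → UVB r sch → ROT r sch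

/-- **Stub 6 — NON-DEGENERACY (L/XL).** Along every scheme of the hypothesis block whose
canonical functionals converge: (ND) the tuning `N_1(k) → θ > 0` (point-split two-point function
at physical distance 1) plus UV-regularity of the canonical two-point kernel away from `0` gives a
smeared OS pair with two-point functional `≥ δ > 0` eventually — this is where `θ > 0` is used
(`not_withoutAF`); (NG) the connected three-point function of `tr F²` on some separated triple
stays away from `0` infinitely often (asymptotic freedom at short distance: leading free
Wick-square triangle `∝ dim G · C(x−y)C(y−z)C(z−x) ≠ 0`; Disproof §8 kill target IV′ is its
negation). [cite: JaffeWitten2000, §4] -/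
def NonDegeneracy : Prop :=
  ∀ (G : Type) [Group G] [TopologicalSpace G] [IsTopologicalGroup G] [CompactSpace G],
    IsCompactSimpleLieGroup G →
      letI : MeasurableSpace G := borel G
      haveI : BorelSpace G := ⟨rfl⟩
      ∀ (r : LatticeRep G) (M : ℕ) (θ Δ : ℝ) (sch : SpeciesScheme (YMSpecies G)) (n : ℕ → ℕ),
        2 ≤ M → 0 < θ → 0 < Δ → CruxHyp r M θ Δ sch n → CurvConv r sch → ND r sch ∧ NG r sch

/-- **Stub 7 — OS PACKAGING (soft, M/L).** Full-sequence convergence of the canonical curvature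
functionals on off-diagonal real product tensors + uniform E0' bounds + uniform OS clustering +
rotation restoration + the two lower bounds ⇒ OS data `T` (species other than the curvature
carry the zero distribution; zero-extension preserves E0–E4) with `IsYangMillsFor r (canon r sch) T`
(curvature string: `latticeSchwinger (canon) = curvLS` on product tensors, density of off-diagonal
product tensors in `⁰𝒮` + equicontinuity from UVB, Hahn–Banach; other strings: `c_s = 0`),
E0' (UVB), E1 (lattice translations + equicontinuity; ROT), E2 (site reflection positivity of
Wilson's action, tree `TorusSiteRP`/`WilsonSiteRPForm`, the unit time-shift of the corner density
absorbed by UVB), E3 (exact), E4 + clustering (CL), `IsNontrivial` (ND, one-point functions vanish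
by the vacuum subtraction), `IsNonGaussian` (NG). Full-sequence analogue of route
`FlowLineStateSpace`'s support item `OSLimitFromUniformBounds`. [cite: OsterwalderSchrader1975, Thm E→R] [cite: GlimmJaffe1987, §6.1] -/
def OSPackaging : Prop :=
  ∀ (G : Type) [Group G] [TopologicalSpace G] [IsTopologicalGroup G] [CompactSpace G],
    IsCompactSimpleLieGroup G →
      letI : MeasurableSpace G := borel G
      haveI : BorelSpace G := ⟨rfl⟩
      ∀ (r : LatticeRep G) (sch : SpeciesScheme (YMSpecies G)),
        CurvConv r sch → UVB r sch → CL r sch → ROT r sch → ND r sch → NG r sch →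
          ∃ T : OSData (YMSpecies G) 4,
            IsYangMillsFor r (canon r sch) T ∧ T.IsNontrivial r.curvature ∧ T.IsNonGaussian r.curvature

/-! ### Registered stubs -/

/-- Stub 1 (ENGINE, hardest). -/
theorem stub_flowedFreeEnergyLimit : FlowedFreeEnergyLimit := by
  sorry

/-- Stub 2 (Curtiss transfer; true, M). -/
theorem stub_jointMomentsOfMGFLimit : JointMomentsOfMGFLimit := by
  sorry

/-- Stub 3 (small-flow-time transfer + uniform E0'). -/
theorem stub_smallFlowTimeTransfer : SmallFlowTimeTransfer := by
  sorry

/-- Stub 4 (uniform clustering from the lattice gap). -/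
theorem stub_uniformClustering : UniformClustering := by
  sorry

/-- Stub 5 (rotation restoration, imported E1). -/
theorem stub_rotationRestoration : RotationRestoration := by
  sorry

/-- Stub 6 (non-degeneracy: ND from `θ > 0`, NG from asymptotic freedom). -/
theorem stub_nonDegeneracy : NonDegeneracy := by
  sorry

/-- Stub 7 (OS packaging). -/
theorem stub_osPackaging : OSPackaging := by
  sorry

/-! ### The 3ε step and the composition (no `sorry` below this line) -/

/-- **3ε lemma.** A real sequence that is, for every `ε > 0`, eventually `ε`-close to SOME
convergent sequence is Cauchy, hence convergent. [folklore] -/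
theorem tendsto_of_eventually_approx {u : ℕ → ℝ}
    (h : ∀ ε : ℝ, 0 < ε → ∃ v : ℕ → ℝ, (∃ c, Tendsto v atTop (𝓝 c)) ∧ ∀ᶠ k in atTop, |u k - v k| ≤ ε) :
    ∃ c, Tendsto u atTop (𝓝 c) := by
  have hc : CauchySeq u := by
    refine Metric.cauchySeq_iff.2 fun ε hε => ?_
    obtain ⟨v, ⟨c, hv⟩, huv⟩ := h (ε / 4) (by positivity)
    obtain ⟨N₁, hN₁⟩ := Metric.cauchySeq_iff.1 hv.cauchySeq (ε / 4) (by positivity)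
    obtain ⟨N₂, hN₂⟩ := eventually_atTop.1 huv
    refine ⟨max N₁ N₂, fun m hm n hn => ?_⟩
    have h1 := hN₂ m (le_of_max_le_right hm)
    have h2 := hN₂ n (le_of_max_le_right hn)
    have h3 := hN₁ m (le_of_max_le_left hm) n (le_of_max_le_left hn)
    rw [Real.dist_eq] at h3 ⊢
    have h2' : |v n - u n| ≤ ε / 4 := by rw [abs_sub_comm]; exact h2
    calc |u m - u n| = |(u m - v m) + (v m - v n) + (v n - u n)| := by ring_nf
      _ ≤ |u m - v m| + |v m - v n| + |v n - u n| := abs_add_three _ _ _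
      _ < ε := by linarith
  exact cauchySeq_tendsto_of_complete hc

section Compose

variable {G : Type} [Group G] [TopologicalSpace G] [IsTopologicalGroup G] [CompactSpace G]
  [MeasurableSpace G] [BorelSpace G]

/-- **Flowed moments converge at every flow time + uniform small-flow-time approximation ⇒ the
canonical unflowed curvature functionals converge along the full sequence** (3ε). [folklore] -/
theorem curvConv_of_sft (r : LatticeRep G) (sch : SpeciesScheme (YMSpecies G))
    (hMom : FlowMomentsConv r sch) (hSFT : SFTApprox r sch) : CurvConv r sch := by
  obtain ⟨cE, hS⟩ := hSFT
  intro m hm f F hF hoff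
  refine tendsto_of_eventually_approx fun ε hε => ?_
  obtain ⟨τ, hτ, hev⟩ := hS m hm f F hF hoff ε hε
  obtain ⟨c, hc⟩ := hMom m f τ hτ
  exact ⟨fun k => cE τ ^ m * flowCMoment r sch τ m f k, ⟨cE τ ^ m * c, hc.const_mul _⟩, hev⟩

end Compose

/-- **Composition (kernel-checked).** The seven stub statements imply crux (A)
`ParabolicTrajectory.ContinuumLimitOnTrajectory` BY NAME: fix `G, r`; `M₀, θ₀` from the engine;
for a scheme in the hypothesis block, ENGINE ⇒ flowed free energies converge, CURTISS ⇒ flowed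
moments converge, SMALL FLOW TIME + 3ε ⇒ canonical functionals converge (and UVB), then CL, ROT,
ND, NG, and OS PACKAGING gives `T`; the witness scheme is `canon r sch` (same `a, β, L`). -/
theorem ContinuumLimitOnTrajectory_of :
    FlowedFreeEnergyLimit → JointMomentsOfMGFLimit → SmallFlowTimeTransfer → UniformClustering →
      RotationRestoration → NonDegeneracy → OSPackaging → ContinuumLimitOnTrajectory := by
  intro hE hC hS hU hR hN hP G _ _ _ _ hG
  letI : MeasurableSpace G := borel G
  haveI : BorelSpace G := ⟨rfl⟩
  intro r
  obtain ⟨M₀, hM₀⟩ := hE G hG r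
  refine ⟨M₀, fun M hM h2 => ?_⟩
  obtain ⟨θ₀, hθ₀, hθ⟩ := hM₀ M hM h2
  refine ⟨θ₀, hθ₀, fun θ Δ sch n h0 h1 hΔ ha hβ hconv htune hgap => ?_⟩
  have hH : CruxHyp r M θ Δ sch n := ⟨ha, hβ, hconv, htune, hgap⟩
  have hFFE : FFEConv r sch := hθ θ Δ sch n h0 h1 hΔ hH
  have hMom : FlowMomentsConv r sch := hC G hG r sch hFFE
  obtain ⟨hSFT, hUVB⟩ := hS G hG r M θ Δ sch n h2 h0 hΔ hH
  have hConv : CurvConv r sch := curvConv_of_sft r sch hMom hSFT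
  have hCL : CL r sch := hU G hG r M θ Δ sch n h2 h0 hΔ hH hUVB
  have hROT : ROT r sch := hR G hG r M θ Δ sch n h2 h0 hΔ hH hConv hUVB
  obtain ⟨hND, hNG⟩ := hN G hG r M θ Δ sch n h2 h0 hΔ hH hConv
  obtain ⟨T, hYM, hNT, hNGs⟩ := hP G hG r sch hConv hUVB hCL hROT hND hNG
  exact ⟨canon r sch, rfl, rfl, rfl, T, hYM, hNT, hNGs⟩

/-- The same composition with the registered stubs plugged in (its only `sorry`s are theirs). -/
theorem continuumLimitOnTrajectory_skeleton : ContinuumLimitOnTrajectory :=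
  ContinuumLimitOnTrajectory_of stub_flowedFreeEnergyLimit stub_jointMomentsOfMGFLimit
    stub_smallFlowTimeTransfer stub_uniformClustering stub_rotationRestoration stub_nonDegeneracy
    stub_osPackaging

/-! ### Read-back checks (no `sorry`) -/

section ReadBack

variable {G : Type} [Group G] [TopologicalSpace G] [IsTopologicalGroup G] [CompactSpace G]
  [MeasurableSpace G] [BorelSpace G]

/-- `CruxConcl` for the canonical witness: what `stub_osPackaging` delivers is literally the
conclusion of the crux for `(r, sch)`. [folklore] -/
theorem cruxConcl_of_canon (r : LatticeRep G) (sch : SpeciesScheme (YMSpecies G))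
    (h : ∃ T : OSData (YMSpecies G) 4,
      IsYangMillsFor r (canon r sch) T ∧ T.IsNontrivial r.curvature ∧ T.IsNonGaussian r.curvature) :
    CruxConcl r sch := by
  obtain ⟨T, hT⟩ := h
  exact ⟨canon r sch, rfl, rfl, rfl, T, hT⟩

/-- Zero-point normalisation of the canonical functional is automatic: `curvLS k 0 F = F default`
(E0 for free; sanity check of the general-tensor functional). [folklore] -/
theorem curvLS_zero (r : LatticeRep G) (sch : SpeciesScheme (YMSpecies G)) (k : ℕ)
    (F : 𝓢((Fin 0 → 𝔼), ℂ)) (hμ : IsProbabilityMeasure (μW r sch k)) :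
    curvLS r sch k 0 F = F default := by
  unfold curvLS
  have h1 : ∀ (U : GaugeConfig 4 (sch.side k) G) (x : Fin 0 → ↥(box 4 (sch.L k))),
      F (fun i => sch.a k • siteToE (↑(x i) : Literature.Probability.LatticeModels.Site 4)) *
        ∏ i, (((r.curvature.F (configShift (-(↑(x i) : Literature.Probability.LatticeModels.Site 4))
          (torusLift (sch.side k) U)) - vacMean r sch k : ℝ) : ℂ)) = F default := by
    intro U x
    rw [Finset.univ_eq_empty, Finset.prod_empty, mul_one]
    congr 1
    exact Subsingleton.elim _ _
  simp_rw [h1]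
  simp

end ReadBack

/-- The crux, read back: `ContinuumLimitOnTrajectory ↔ ∀ … , CruxHyp → CruxConcl`. [folklore] -/
theorem crux_iff_hyp_concl :
    ContinuumLimitOnTrajectory ↔
      ∀ (G : Type) [Group G] [TopologicalSpace G] [IsTopologicalGroup G] [CompactSpace G],
        IsCompactSimpleLieGroup G →
          letI : MeasurableSpace G := borel G
          haveI : BorelSpace G := ⟨rfl⟩
          ∀ r : LatticeRep G, ∃ M₀ : ℕ, ∀ M : ℕ, M₀ ≤ M → 2 ≤ M → ∃ θ₀ : ℝ, 0 < θ₀ ∧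
            ∀ (θ Δ : ℝ) (sch : SpeciesScheme (YMSpecies G)) (n : ℕ → ℕ),
              0 < θ → θ < θ₀ → 0 < Δ → CruxHyp r M θ Δ sch n → CruxConcl r sch := by
  unfold ContinuumLimitOnTrajectory CruxHyp CruxConcl
  refine forall_congr' fun G => forall_congr' fun _ => forall_congr' fun _ =>
    forall_congr' fun _ => forall_congr' fun _ => forall_congr' fun _ => forall_congr' fun r =>
    exists_congr fun M₀ => forall_congr' fun M => forall_congr' fun _ => forall_congr' fun _ =>
    exists_congr fun θ₀ => and_congr Iff.rfl <| forall_congr' fun θ => forall_congr' fun Δ =>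
    forall_congr' fun sch => forall_congr' fun n => forall_congr' fun _ => forall_congr' fun _ =>
    forall_congr' fun _ => ⟨fun h H => h H.1 H.2.1 H.2.2.1 H.2.2.2.1 H.2.2.2.2,
      fun h h1 h2 h3 h4 h5 => h ⟨h1, h2, h3, h4, h5⟩⟩

end Summit.QuantumFields.YangMills.Cruxes.ContinuumLimitOnTrajectory.CurtissFlowedFreeEnergies

end
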